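import Literature.AlgebraicGeometry.Resolution.RegularLocalRingsNormal
import Literature.AlgebraicGeometry.Resolution.ResolutionOfComponents
import Literature.AlgebraicGeometry.Resolution.PrincipalizationToResolution
import Mathlib.AlgebraicGeometry.ValuativeCriterion
import Mathlib.AlgebraicGeometry.FunctionField
import Mathlib.AlgebraicGeometry.Stalk
import Mathlib.RingTheory.Valuation.ValuationSubring

/-!
# Negative lemma for crux `PicoverLocalModel` (stmt-ResolutionOfSingularities-0557), the link:
# a weak resolution of `Spec B` forces the valuation-ring normalization of `B` to be finite

Discharges the hypothesis `hL` of the companion `FiniteTypeLoadBearing.lean` in the form needed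
there, and shows that Nagata-type rings have no resolution even in the weak sense
`Scheme.HasResolution` (cf. `Literature.Barriers.ResolutionOfSingularities.QuasiExcellenceNecessary`,
scope caveat (c)). **Theorem** (`finite_of_hasResolution`): `B` a domain, `F = Frac B`, `W ⊆ F` a
valuation ring containing `B` and integral over `B`; if `Spec B` has a resolution in the weak sense
then `W` is a finite `B`-module. *Proof.* `X'` is integral (`isIntegral_of_isBirational`) and the
generic fibre `Spec F → X'` hits its generic point (`exists_genericPoint_lift`); the valuative
criterion (`UniversallyClosed.eq_valuativeCriterion`) lifts `Spec W → Spec B` to `l : Spec W → X'`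
(`exists_lift`); the local homomorphism `θ : 𝒪_{X',l(𝔪)} → W` (`Scheme.stalkClosedPointTo`) is
injective because `l` preserves generic points (`stalkClosedPointTo_injective`), its source is
regular hence a normal domain (Matsumura 19.4, `isIntegrallyClosed_of_isRegularLocalRing`), its
image contains `B` (`germ_stalkMap_stalkClosedPointTo`) and `W` is integral over it, so `θ` is onto
(`surjective_of_isIntegrallyClosed`); and `𝒪_{X',x'}` is a localization of the finitely generated
`B`-algebra `Γ(X', V)` (`IsAffineOpen.isLocalization_stalk`, `Scheme.Hom.finiteType_appLE`), so
`W` is generated by fractions with unit denominators over a finitely generated subalgebra over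
which it is integral — such a `W` equals that subalgebra and is finite (`inv_mem_of_isIntegral`,
`finite_of_fraction_generation`). Folklore (the mechanism of EGA IV₂ 7.9.5 / Kollár 2007, 1.101).
-/

noncomputable section

open CategoryTheory AlgebraicGeometry TopologicalSpace IsLocalRing
open Literature.AlgebraicGeometry.Resolution

set_option linter.dupNamespace false

namespace Summit.ResolutionOfSingularities.ResolutionOfSingularities.Theorems.PicoverLocalModel.Negative

universe u

section Generic

variable {B F : Type u} [CommRing B] [IsDomain B] [Field F] [Algebra B F] [IsFractionRing B F]

/-- The generic point `(0)` of `Spec B` lies in every dense open. [folklore] -/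
theorem bot_mem_of_dense (U : (Spec (.of B)).Opens) (hU : Dense (U : Set (Spec (.of B)))) :
    (⊥ : PrimeSpectrum B) ∈ U := by
  obtain ⟨x, hx⟩ := hU.nonempty
  have hspec : (⊥ : PrimeSpectrum B) ⤳ x := (PrimeSpectrum.le_iff_specializes _ _).mp bot_le
  exact hspec.mem_open U.isOpen hx

variable (B F) in
/-- The image of `Spec (Frac B) → Spec B` is the generic point. [folklore] -/
theorem specMap_algebraMap_apply (z : Spec (.of F)) :
    (Spec.map (CommRingCat.ofHom (algebraMap B F))) z = (⊥ : PrimeSpectrum B) := by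
  apply PrimeSpectrum.ext
  change Ideal.comap (algebraMap B F) z.asIdeal = ⊥
  have hz : z.asIdeal = ⊥ := (Ideal.eq_bot_or_top z.asIdeal).resolve_right z.isPrime.ne_top
  rw [hz, Ideal.comap_bot_of_injective _ (IsFractionRing.injective B F)]

end Generic

section Birational

variable {B : Type u} [CommRing B] [IsDomain B]

/-- A reduced scheme birational (iso over a dense open with dense preimage) to the spectrum of a
domain is integral. [folklore] -/
theorem isIntegral_of_isBirational {X' : Scheme.{u}} [IsReduced X'] (π : X' ⟶ Spec (.of B))
    (U : (Spec (.of B)).Opens) (hU : Dense (U : Set (Spec (.of B))))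
    (hU' : Dense ((π ⁻¹ᵁ U : X'.Opens) : Set X')) [IsIso (π ∣_ U)] : IsIntegral X' := by
  haveI : Nonempty (U : Scheme.{u}) := ⟨⟨(⊥ : PrimeSpectrum B), bot_mem_of_dense U hU⟩⟩
  haveI : IsIntegral (U : Scheme.{u}) := inferInstance
  haveI : Nonempty (↑(π ⁻¹ᵁ U) : Scheme.{u}) := ⟨(inv (π ∣_ U)) (Classical.arbitrary _)⟩
  haveI : IsIntegral (↑(π ⁻¹ᵁ U) : Scheme.{u}) := isIntegral_of_isOpenImmersion (π ∣_ U)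
  have hirr : IsIrreducible ((π ⁻¹ᵁ U : X'.Opens) : Set X') := by
    have h1 : IsIrreducible (Set.univ : Set (↑(π ⁻¹ᵁ U) : Scheme.{u})) :=
      IrreducibleSpace.isIrreducible_univ _
    have h2 := h1.image (π ⁻¹ᵁ U).ι.base (π ⁻¹ᵁ U).ι.continuous.continuousOn
    rwa [Set.image_univ, Scheme.Opens.range_ι] at h2
  haveI : IrreducibleSpace X' := by
    rw [irreducibleSpace_def, Set.top_eq_univ, ← hU'.closure_eq]
    exact isIrreducible_iff_closure.mpr hirr
  exact (isIntegral_iff_irreducibleSpace_and_isReduced X').mpr ⟨inferInstance, inferInstance⟩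

variable {F : Type u} [Field F] [Algebra B F] [IsFractionRing B F]

/-- The generic fibre of a birational `π : X' → Spec B`: a morphism `Spec (Frac B) → X'` over
`Spec B` hitting the generic point of `X'`. [folklore] -/
theorem exists_genericPoint_lift {X' : Scheme.{u}} [IsIntegral X'] (π : X' ⟶ Spec (.of B))
    (U : (Spec (.of B)).Opens) (hU : Dense (U : Set (Spec (.of B)))) [IsIso (π ∣_ U)] :
    ∃ i₁ : Spec (.of F) ⟶ X', i₁ ≫ π = Spec.map (CommRingCat.ofHom (algebraMap B F)) ∧
      ∀ z, i₁ z = genericPoint X' := by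
  haveI : Nonempty (U : Scheme.{u}) := ⟨⟨(⊥ : PrimeSpectrum B), bot_mem_of_dense U hU⟩⟩
  haveI : IsIntegral (U : Scheme.{u}) := inferInstance
  haveI : Nonempty (↑(π ⁻¹ᵁ U) : Scheme.{u}) := ⟨(inv (π ∣_ U)) (Classical.arbitrary _)⟩
  haveI : IsIntegral (↑(π ⁻¹ᵁ U) : Scheme.{u}) := isIntegral_of_isOpenImmersion (π ∣_ U)
  set j₀ := Spec.map (CommRingCat.ofHom (algebraMap B F)) with hj₀
  have hrange : Set.range j₀ ⊆ Set.range U.ι := by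
    rintro _ ⟨z, rfl⟩
    rw [Scheme.Opens.range_ι, hj₀, specMap_algebraMap_apply B F z]
    exact bot_mem_of_dense U hU
  set j₁ := IsOpenImmersion.lift U.ι j₀ hrange with hj₁
  refine ⟨j₁ ≫ inv (π ∣_ U) ≫ (π ⁻¹ᵁ U).ι, ?_, fun z => ?_⟩
  · rw [Category.assoc, Category.assoc, ← morphismRestrict_ι, IsIso.inv_hom_id_assoc,
      IsOpenImmersion.lift_fac]
  · have h1 : j₁ z = genericPoint (U : Scheme.{u}) := by
      apply U.ι.isOpenEmbedding.injective
      rw [← Scheme.Hom.comp_apply, hj₁, IsOpenImmersion.lift_fac, genericPoint_eq_of_isOpenImmersion,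
        genericPoint_eq_bot_of_affine, hj₀, specMap_algebraMap_apply B F z]
    rw [Scheme.Hom.comp_apply, Scheme.Hom.comp_apply, h1, genericPoint_eq_of_isOpenImmersion,
      genericPoint_eq_of_isOpenImmersion]

end Birational

section Lift

variable {B F : Type u} [CommRing B] [Field F] [Algebra B F]

/-- **Valuative criterion, applied.** A universally closed `π : X' → Spec B`, a lift
`i₁ : Spec F → X'` of `Spec F → Spec B`, and a valuation ring `W` of `F` containing `B` give a
morphism `Spec W → X'` compatible with both. [folklore] -/
theorem exists_lift {X' : Scheme.{u}} (π : X' ⟶ Spec (.of B)) [UniversallyClosed π]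
    (i₁ : Spec (.of F) ⟶ X') (hi₁ : i₁ ≫ π = Spec.map (CommRingCat.ofHom (algebraMap B F)))
    (W : ValuationSubring F) (bw : B →+* W)
    (hbw : (algebraMap W F).comp bw = algebraMap B F) :
    ∃ l : Spec (.of W) ⟶ X', Spec.map (CommRingCat.ofHom (algebraMap W F)) ≫ l = i₁ ∧
      l ≫ π = Spec.map (CommRingCat.ofHom bw) := by
  have hE : ValuativeCriterion.Existence π := by
    have h := (inferInstance : UniversallyClosed π); rw [UniversallyClosed.eq_valuativeCriterion] at h
    exact h.1
  have hsq : CommSq i₁ (Spec.map (CommRingCat.ofHom (algebraMap W F))) π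
      (Spec.map (CommRingCat.ofHom bw)) := ⟨by
    rw [hi₁, ← Spec.map_comp, ← CommRingCat.ofHom_comp, hbw]⟩
  let sq : ValuativeCommSq π := ⟨W, F, i₁, Spec.map (CommRingCat.ofHom bw), hsq⟩
  haveI : sq.commSq.HasLift := hE sq
  exact ⟨sq.commSq.lift, sq.commSq.fac_left, sq.commSq.fac_right⟩

end Lift

section Inject

variable {W : Type u} [CommRing W] [IsLocalRing W] [IsDomain W]

/-- If `l : Spec W → X'` (`W` a local domain, `X'` integral) sends the generic point of `Spec W`
to the generic point of `X'`, then the induced local homomorphism `𝒪_{X', l(𝔪)} → W` is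
injective. [folklore] -/
theorem stalkClosedPointTo_injective {X' : Scheme.{u}} [IsIntegral X'] (l : Spec (.of W) ⟶ X')
    (hl : l (⟨⊥, Ideal.isPrime_bot⟩ : PrimeSpectrum W) = genericPoint X') :
    Function.Injective (Scheme.stalkClosedPointTo l).hom := by
  have h₁ : (⟨⊥, Ideal.isPrime_bot⟩ : PrimeSpectrum W) ⤳ closedPoint W := specializes_closedPoint _
  have h₂ := h₁.map l.continuous
  have hnat := l.stalkSpecializes_stalkMap _ _ h₁
  intro a b hab
  have key : (X'.presheaf.stalkSpecializes h₂).hom a = (X'.presheaf.stalkSpecializes h₂).hom b := by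
    have hfield : Function.Injective (l.stalkMap (⟨⊥, Ideal.isPrime_bot⟩ : PrimeSpectrum W)).hom := by
      have hF : IsField (X'.presheaf.stalk (l (⟨⊥, Ideal.isPrime_bot⟩ : PrimeSpectrum W))) := by
        rw [hl]
        exact Field.toIsField X'.functionField
      letI := hF.toField
      exact (l.stalkMap (⟨⊥, Ideal.isPrime_bot⟩ : PrimeSpectrum W)).hom.injective
    apply hfield
    change (X'.presheaf.stalkSpecializes h₂ ≫ l.stalkMap (⟨⊥, Ideal.isPrime_bot⟩ : PrimeSpectrum W)).hom a =
      (X'.presheaf.stalkSpecializes h₂ ≫ l.stalkMap (⟨⊥, Ideal.isPrime_bot⟩ : PrimeSpectrum W)).hom b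
    rw [hnat]
    change ((Spec (.of W)).presheaf.stalkSpecializes h₁).hom ((l.stalkMap (closedPoint W)).hom a) =
      ((Spec (.of W)).presheaf.stalkSpecializes h₁).hom ((l.stalkMap (closedPoint W)).hom b)
    have hab' : (l.stalkMap (closedPoint W)).hom a = (l.stalkMap (closedPoint W)).hom b := by
      have := congrArg (stalkClosedPointIso (.of W)).inv.hom hab
      simpa [Scheme.stalkClosedPointTo, ← CommRingCat.comp_apply] using this
    rw [hab']
  have hinj : ∀ (y : X') (hy : y = genericPoint X') (h : y ⤳ l (closedPoint W)),
      Function.Injective (X'.presheaf.stalkSpecializes h).hom := by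
    intro y hy h
    subst hy
    exact IsFractionRing.injective (X'.presheaf.stalk (l (closedPoint W))) X'.functionField
  exact hinj _ hl h₂ key

end Inject

section Normal

/-- **Normal subrings swallow integral valuation data.** `θ : C → Wt` injective with `C`
integrally closed, `Wt ⊆ F` (injective structure map), `B → Wt → F` a tower with `F = Frac B`,
`θ(C) ⊇ B`, and every element of `Wt` integral over `B`: then `θ` is surjective. [folklore] -/
theorem surjective_of_isIntegrallyClosed {B C Wt F : Type*} [CommRing B] [CommRing C] [IsDomain C]
    [IsIntegrallyClosed C] [CommRing Wt] [Field F] [Algebra B F] [IsFractionRing B F]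
    [Algebra Wt F] (hWF : Function.Injective (algebraMap Wt F)) [Algebra B Wt]
    [IsScalarTower B Wt F] (θ : C →+* Wt) (hθ : Function.Injective θ)
    (hB : ∀ b : B, algebraMap B Wt b ∈ θ.range) (hint : Algebra.IsIntegral B Wt) :
    Function.Surjective θ := by
  set ι : C →+* F := (algebraMap Wt F).comp θ with hι
  have hιinj : Function.Injective ι := hWF.comp hθ
  set A : Subring F := ι.range with hA
  let e : C ≃+* A := RingEquiv.ofBijective ι.rangeRestrict
    ⟨fun x y hxy => hιinj (congrArg Subtype.val hxy), ι.rangeRestrict_surjective⟩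
  haveI : IsIntegrallyClosed A := IsIntegrallyClosed.of_equiv e
  have hBA : ∀ b : B, algebraMap B F b ∈ A := fun b => by
    obtain ⟨c, hc⟩ := hB b
    refine ⟨c, ?_⟩
    rw [hι, RingHom.comp_apply, hc, ← IsScalarTower.algebraMap_apply]
  haveI : IsFractionRing A F := by
    refine IsFractionRing.of_field A F fun z => ?_
    obtain ⟨a, b, hb, rfl⟩ := IsFractionRing.div_surjective (A := B) z
    exact ⟨⟨_, hBA a⟩, ⟨_, hBA b⟩, rfl⟩
  intro w
  have hw : IsIntegral A (algebraMap Wt F w) := by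
    obtain ⟨q, hq, hq0⟩ := hint.isIntegral w
    let g : B →+* A := (algebraMap B F).codRestrict A hBA
    refine ⟨q.map g, hq.map g, ?_⟩
    rw [Polynomial.eval₂_map]
    have hg : (algebraMap A F).comp g = algebraMap B F := RingHom.ext fun b => rfl
    rw [hg, ← Polynomial.aeval_def, Polynomial.aeval_algebraMap_apply, Polynomial.aeval_def, hq0,
      map_zero]
  obtain ⟨⟨y, c, rfl⟩, hy⟩ := (isIntegrallyClosed_iff F).mp inferInstance hw
  refine ⟨c, hWF ?_⟩
  exact hy

end Normal

section Compat

variable {W : Type u} [CommRing W] [IsLocalRing W]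

/-- Transport of `germ ≫ stalkClosedPointTo` along an equality of morphisms `Spec W → Y`. [folklore] -/
theorem germ_stalkClosedPointTo_congr {Y : Scheme.{u}} {f g : Spec (.of W) ⟶ Y} (h : f = g) :
    Y.presheaf.germ ⊤ (f (closedPoint W)) trivial ≫ Scheme.stalkClosedPointTo f =
      Y.presheaf.germ ⊤ (g (closedPoint W)) trivial ≫ Scheme.stalkClosedPointTo g := by subst h; rfl

/-- **Compatibility with the base.** If `l ≫ π = Spec φ` then on global sections of the base,
`germ ≫ π^* ≫ (𝒪_{X', x'} → W) = ΓSpecIso ≫ φ`. [folklore] -/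
theorem germ_stalkMap_stalkClosedPointTo {X' : Scheme.{u}} {R : CommRingCat.{u}}
    (l : Spec (.of W) ⟶ X') (π : X' ⟶ Spec R) (φ : R ⟶ CommRingCat.of W)
    (h : l ≫ π = Spec.map φ) :
    (Spec R).presheaf.germ ⊤ (π (l (closedPoint W))) trivial ≫ π.stalkMap (l (closedPoint W)) ≫
      Scheme.stalkClosedPointTo l = (Scheme.ΓSpecIso R).hom ≫ φ := by
  have e1 := germ_stalkClosedPointTo_congr h
  rw [Scheme.stalkClosedPointTo_comp l π, Scheme.germ_stalkClosedPointTo_Spec φ] at e1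
  exact e1

end Compat

section Algebra

/-- In an integral extension `D' ⊆ W`, a unit of `W` lying in `D'` has its inverse in `D'`. [folklore] -/
theorem inv_mem_of_isIntegral {B W : Type*} [CommRing B] [CommRing W] [Algebra B W]
    (D' : Subalgebra B W) [Algebra.IsIntegral D' W] (u : Wˣ) (hu : (u : W) ∈ D') :
    (↑u⁻¹ : W) ∈ D' := by
  obtain ⟨p, hp, hp0⟩ : IsIntegral D' (↑u⁻¹ : W) := Algebra.IsIntegral.isIntegral _
  haveI : Invertible (↑u⁻¹ : W) := u⁻¹.invertible
  have hrev : Polynomial.eval₂ (algebraMap D' W) (u : W) p.reverse = 0 := by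
    have := (Polynomial.eval₂_reverse_eq_zero_iff (algebraMap D' W) (↑u⁻¹ : W) p).mpr hp0
    simpa [invOf_units] using this
  have hsplit := Polynomial.X_mul_divX_add p.reverse
  have hc0 : p.reverse.coeff 0 = 1 := by
    rw [Polynomial.coeff_zero_reverse, hp.leadingCoeff]
  rw [hc0, map_one] at hsplit
  have heval : (u : W) * Polynomial.eval₂ (algebraMap D' W) (u : W) p.reverse.divX + 1 = 0 := by
    have := congrArg (Polynomial.eval₂ (algebraMap D' W) (u : W)) hsplit
    rw [Polynomial.eval₂_add, Polynomial.eval₂_mul, Polynomial.eval₂_X, Polynomial.eval₂_one,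
      hrev] at this
    exact this
  have hinv : (↑u⁻¹ : W) = -Polynomial.eval₂ (algebraMap D' W) (u : W) p.reverse.divX := by
    have h1 : (u : W) * (-Polynomial.eval₂ (algebraMap D' W) (u : W) p.reverse.divX) = 1 := by
      linear_combination -heval
    calc (↑u⁻¹ : W) = ↑u⁻¹ * ((u : W) * -Polynomial.eval₂ (algebraMap D' W) (u : W) p.reverse.divX)
          := by rw [h1, mul_one]
      _ = -Polynomial.eval₂ (algebraMap D' W) (u : W) p.reverse.divX := by
          rw [← mul_assoc, Units.inv_mul, one_mul]
  rw [hinv]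
  refine D'.neg_mem ?_
  have hu' : (u : W) = algebraMap D' W ⟨u, hu⟩ := rfl
  rw [hu', Polynomial.eval₂_at_apply]
  exact SetLike.coe_mem _

/-- **Finiteness from generation by fractions with unit denominators.** If `W` is integral over
`B` and every element of `W` is `d · s⁻¹` with `d, s` in a finitely generated `B`-subalgebra `D'`
and `s` a unit of `W`, then `W = D'` is a finite `B`-module. [folklore] -/
theorem finite_of_fraction_generation {B W : Type*} [CommRing B] [CommRing W] [Algebra B W]
    [Algebra.IsIntegral B W] (D' : Subalgebra B W) (hfg : D'.FG)
    (hgen : ∀ w : W, ∃ d ∈ D', ∃ s : Wˣ, (s : W) ∈ D' ∧ w * s = d) : Module.Finite B W := by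
  have htop : D' = ⊤ := by
    refine eq_top_iff.mpr fun w _ => ?_
    obtain ⟨d, hd, s, hs, hw⟩ := hgen w
    haveI : Algebra.IsIntegral D' W := Algebra.IsIntegral.tower_top (R := B)
    have hsinv := inv_mem_of_isIntegral D' s hs
    have : w = d * ↑s⁻¹ := by rw [← hw, mul_assoc, Units.mul_inv, mul_one]
    rw [this]
    exact D'.mul_mem hd hsinv
  have hft : Algebra.FiniteType B W := ⟨by rw [← htop]; exact hfg⟩
  exact Algebra.finite_iff_isIntegral_and_finiteType.mpr ⟨inferInstance, hft⟩

end Algebra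

section Main

variable {B F : Type u} [CommRing B] [IsDomain B] [Field F] [Algebra B F] [IsFractionRing B F]

/-- **If the spectrum of a domain `B` has a resolution in the weak sense and `W` is a valuation
ring of `Frac B` containing `B` and integral over `B` (i.e. `W` is the normalization of `B` and is
a valuation ring), then `W` is a finite `B`-module.** [folklore] -/
theorem finite_of_hasResolution (W : ValuationSubring F) [Algebra B W] [IsScalarTower B W F]
    [Algebra.IsIntegral B W] (hres : Scheme.HasResolution (Spec (.of B))) : Module.Finite B W := by
  obtain ⟨X', π, hπ⟩ := hres
  haveI : IsProper π := hπ.isProper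
  haveI : IsReduced X' :=
    Literature.AlgebraicGeometry.Resolution.Scheme.IsRegular.isReduced hπ.isRegular
  obtain ⟨U, hU, hU', hiso⟩ := hπ.isBirational
  haveI := hiso
  haveI : IsIntegral X' := isIntegral_of_isBirational π U hU hU'
  obtain ⟨i₁, hi₁, hgen⟩ := exists_genericPoint_lift (F := F) π U hU
  have hbw : (algebraMap W F).comp (algebraMap B W) = algebraMap B F :=
    (IsScalarTower.algebraMap_eq B W F).symm
  obtain ⟨l, hl₁, hl₂⟩ := exists_lift π i₁ hi₁ W (algebraMap B W) hbw
  have hlgen : l (⟨⊥, Ideal.isPrime_bot⟩ : PrimeSpectrum W) = genericPoint X' := by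
    have h1 : (Spec.map (CommRingCat.ofHom (algebraMap W F)) ≫ l) (closedPoint F) =
        genericPoint X' := by
      rw [hl₁]
      exact hgen _
    rw [Scheme.Hom.comp_apply, specMap_algebraMap_apply W F] at h1
    exact h1
  have hθinj : Function.Injective (Scheme.stalkClosedPointTo l).hom :=
    stalkClosedPointTo_injective l hlgen
  haveI : IsRegularLocalRing (X'.presheaf.stalk (l (closedPoint W))) := hπ.isRegular _
  haveI : IsIntegrallyClosed (X'.presheaf.stalk (l (closedPoint W))) :=
    isIntegrallyClosed_of_isRegularLocalRing _
  have hcompat := germ_stalkMap_stalkClosedPointTo l π (CommRingCat.ofHom (algebraMap B W)) hl₂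
  have hB : ∀ b : B, algebraMap B W b ∈ (Scheme.stalkClosedPointTo l).hom.range := fun b => by
    refine ⟨(π.stalkMap (l (closedPoint W))).hom
      (((Spec (.of B)).presheaf.germ ⊤ (π (l (closedPoint W))) trivial).hom
        ((Scheme.ΓSpecIso (.of B)).inv.hom b)), ?_⟩
    have := congrArg (fun f => f.hom ((Scheme.ΓSpecIso (.of B)).inv.hom b)) hcompat
    simp only [CommRingCat.hom_comp, RingHom.comp_apply, CommRingCat.hom_ofHom] at this
    rw [this]
    change algebraMap B W (((Scheme.ΓSpecIso (.of B)).inv ≫ (Scheme.ΓSpecIso (.of B)).hom).hom b) = _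
    rw [Iso.inv_hom_id]; rfl
  have hθsurj : Function.Surjective (Scheme.stalkClosedPointTo l).hom :=
    surjective_of_isIntegrallyClosed (B := B) (F := F) (IsFractionRing.injective W F)
      (Scheme.stalkClosedPointTo l).hom hθinj hB inferInstance
  obtain ⟨V, hV, hxV, -⟩ := exists_isAffineOpen_mem_and_subset (X := X') (x := l (closedPoint W))
    (U := ⊤) trivial
  let xV : V := ⟨l (closedPoint W), hxV⟩
  haveI hloc := hV.isLocalization_stalk xV
  have hφ : (π.appLE ⊤ V le_top).hom.FiniteType := π.finiteType_appLE (isAffineOpen_top _) hV _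
  let φB : B →+* Γ(X', V) := (π.appLE ⊤ V le_top).hom.comp (Scheme.ΓSpecIso (.of B)).inv.hom
  have hφB : φB.FiniteType := by
    refine hφ.comp (RingHom.FiniteType.of_surjective _ fun t => ?_)
    exact ⟨(Scheme.ΓSpecIso (.of B)).hom.hom t, by
      change ((Scheme.ΓSpecIso (.of B)).hom ≫ (Scheme.ΓSpecIso (.of B)).inv).hom t = t; rw [Iso.hom_inv_id]; rfl⟩
  letI : Algebra B Γ(X', V) := φB.toAlgebra
  haveI : Algebra.FiniteType B Γ(X', V) := hφB
  let ψ : Γ(X', V) →+* W :=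
    (Scheme.stalkClosedPointTo l).hom.comp (X'.presheaf.germ V (l (closedPoint W)) hxV).hom
  have hψ : ∀ b : B, ψ (φB b) = algebraMap B W b := fun b => by
    have := congrArg (fun f => f.hom ((Scheme.ΓSpecIso (.of B)).inv.hom b)) hcompat
    simp only [CommRingCat.hom_comp, RingHom.comp_apply, CommRingCat.hom_ofHom] at this
    have e2 : algebraMap B W ((Scheme.ΓSpecIso (.of B)).hom.hom ((Scheme.ΓSpecIso (.of B)).inv.hom b))
        = algebraMap B W b := by
      change algebraMap B W (((Scheme.ΓSpecIso (.of B)).inv ≫ (Scheme.ΓSpecIso (.of B)).hom).hom b)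
        = _
      rw [Iso.inv_hom_id]; rfl
    rw [e2] at this
    rw [← this]
    have E : π.appLE ⊤ V le_top ≫ X'.presheaf.germ V (l (closedPoint W)) hxV =
        (Spec (.of B)).presheaf.germ ⊤ (π (l (closedPoint W))) trivial ≫
          π.stalkMap (l (closedPoint W)) := by
      rw [Scheme.Hom.germ_stalkMap, Scheme.Hom.appLE, Category.assoc, TopCat.Presheaf.germ_res]
    have E' := congrArg (fun f => f.hom ((Scheme.ΓSpecIso (.of B)).inv.hom b)) E
    simp only [CommRingCat.hom_comp, RingHom.comp_apply] at E'
    change (Scheme.stalkClosedPointTo l).hom ((X'.presheaf.germ V (l (closedPoint W)) hxV).hom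
      ((π.appLE ⊤ V le_top).hom ((Scheme.ΓSpecIso (.of B)).inv.hom b))) = _
    rw [E']
  let Ψ : Γ(X', V) →ₐ[B] W := { ψ with commutes' := hψ }
  have hfg : Ψ.range.FG := by
    rw [← Algebra.map_top]
    exact Subalgebra.FG.map _ Algebra.FiniteType.out
  letI : Algebra Γ(X', V) (X'.presheaf.stalk (l (closedPoint W))) :=
    X'.presheaf.algebra_section_stalk xV
  haveI hloc' : IsLocalization.AtPrime (X'.presheaf.stalk (l (closedPoint W)))
      (hV.primeIdealOf xV).asIdeal := hloc
  have hgen' : ∀ w : W, ∃ d ∈ Ψ.range, ∃ s : Wˣ, (s : W) ∈ Ψ.range ∧ w * s = d := by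
    intro w
    obtain ⟨c, rfl⟩ := hθsurj w
    obtain ⟨⟨d, s⟩, rfl⟩ := IsLocalization.mk'_surjective (hV.primeIdealOf xV).asIdeal.primeCompl c
    have hsunit : IsUnit (algebraMap Γ(X', V) (X'.presheaf.stalk (l (closedPoint W))) s) :=
      IsLocalization.map_units _ s
    have hsunit' := hsunit.map (Scheme.stalkClosedPointTo l).hom
    refine ⟨ψ d, ⟨d, rfl⟩, hsunit'.unit, ⟨(s : Γ(X', V)), ?_⟩, ?_⟩
    · rw [IsUnit.unit_spec]; rfl
    · rw [IsUnit.unit_spec, ← map_mul, IsLocalization.mk'_spec]; rfl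
  exact finite_of_fraction_generation Ψ.range hfg hgen'

end Main
end Summit.ResolutionOfSingularities.ResolutionOfSingularities.Theorems.PicoverLocalModel.Negative

end
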